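import Mathlib.Analysis.SpecialFunctions.Complex.Arg
import Literature.Analysis.FluidPDE.KNSSTypeII
import HarnessLib

/-!
# KNSS 2009, proof of Theorem 6.2, Step 2: the blow-up sequence (proved)

Analysis/FluidPDE support file (all results proved) for the decomposition of
`Literature.Analysis.FluidPDE.KNSS2009_regularity_typeI_rate` (`KNSSTypeII`; Koch–Nadirashvili–
Seregin–Šverák, Acta Math. 203 (2009) = arXiv:0709.3599, Theorem 6.2) along its printed proof
(`KNSSTypeIRate`, module docstring, Steps 1–6). This file proves **Step 2** (arXiv p. 12):

> "Let `h(t) = sup_x f(x, t)`, `H(t) = sup_{0 ≤ τ ≤ t} h(τ)`. Assume `f` is not bounded and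
> choose `t_k ↗ T` and `x_k ∈ ℝ³` such that `M_k = f(x_k, t_k) = h(t_k) = H(t_k) ↗ ∞`. Let
> `λ_k = |x'_k|` … We note that the sequence `λ_k` is bounded due to (assumption2)."

for `f(x, t) = |x'| ‖u(t, x)‖` (`|x'| = cylRadius x`) and a field `u` on `(0, T) × ℝ³` bounded
on the sub-slabs `(0, T') × ℝ³`, `T' < T`, with (assumption2) `f ≤ C₂` where `|x'| ≥ R₀`:

* `knss_rMulNorm_le_of_subslab`: `f` is bounded on every sub-slab `(0, T') × ℝ³`, `T' < T`
  (by `C₂` off the cylinder `|x'| < R₀` and by `R₀ sup ‖u‖` inside);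
* `knss_exists_near_running_max`: if `f` is unbounded on `(0, T) × ℝ³`, then above every threshold
  `N` there is a value `f(x, t) ≥ N` which is a **near-maximum of the running supremum**:
  `f ≤ 2 f(x, t)` on `(0, t] × ℝ³`. (The printed exact maximisers `f(x_k, t_k) = H(t_k)` need
  not exist — the suprema over `ℝ³` need not be attained —; the factor `2` only changes the
  constants of the later bounds, cf. `KNSSTypeIRate`, "Constants".)
* `exists_rotZ_eq_single_add_smul`: every point is rotated about the axis onto the half-plane
  `{x₂ = 0, x₁ ≥ 0}`: `R_θ x = x₃ e₃ + |x'| e₁` for some `θ` (polar angle, via `Complex.arg`);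
  with an axisymmetric `u(t, ·)` one may therefore take `x_k = (λ_k, 0, x_{3k})`;
* `knss_exists_blowup_sequence`: the packaged Step 2 — sequences `t_k ∈ [T/2, T)`, axial heights
  `a_k`, radii `0 < λ_k < R₀` and values `M_k ≥ k + 1` with
  `M_k = λ_k ‖u(t_k, a_k e₃ + λ_k e₁)‖` and `f ≤ 2 M_k` on `(0, t_k] × ℝ³`.

## References

* G. Koch, N. Nadirashvili, G. Seregin, V. Šverák, Acta Math. 203 (2009) 83–105 =
  arXiv:0709.3599, proof of Theorem 6.2, p. 12. [KochNadirashviliSereginSverak2009]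
-/

noncomputable section

open Set Function Filter

namespace Literature.Analysis.FluidPDE

/-! ### Polar angle: rotating a point onto the meridian half-plane -/

/-- The point `a e₃ + r e₁ = (r, 0, a)` of the meridian half-plane has cylindrical radius `r`
(`r ≥ 0`). [folklore] -/
theorem cylRadius_single_add_smul {r : ℝ} (hr : 0 ≤ r) (a : ℝ) :
    cylRadius (EuclideanSpace.single 2 a + r • EuclideanSpace.single 0 1 :
      EuclideanSpace ℝ (Fin 3)) = r := by
  simp [cylRadius, Real.sqrt_sq hr]

/-- **Polar angle.** Every `x ∈ ℝ³` is rotated about the axis onto the meridian half-plane: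
`R_θ x = x₃ e₃ + |x'| e₁` for `θ = −arg(x₁ + i x₂)` (KNSS 2009, §1: cylindrical coordinates). [folklore] -/
theorem exists_rotZ_eq_single_add_smul (x : EuclideanSpace ℝ (Fin 3)) :
    ∃ θ : ℝ, rotZ θ x =
      EuclideanSpace.single 2 (x 2) + cylRadius x • EuclideanSpace.single 0 1 := by
  by_cases hx : cylRadius x = 0
  · obtain ⟨h0, h1⟩ := (cylRadius_eq_zero_iff x).1 hx
    refine ⟨0, ?_⟩
    ext i
    fin_cases i <;> simp [hx, h0, h1]
  · set z : ℂ := ⟨x 0, x 1⟩ with hz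
    have hnorm : ‖z‖ = cylRadius x := by
      rw [Complex.norm_eq_sqrt_sq_add_sq, cylRadius]
    have hz0 : z ≠ 0 := by
      intro h
      apply hx
      rw [← hnorm, h, norm_zero]
    have hcos : Real.cos (Complex.arg z) = x 0 / cylRadius x := by
      rw [Complex.cos_arg hz0, hnorm]
    have hsin : Real.sin (Complex.arg z) = x 1 / cylRadius x := by
      rw [Complex.sin_arg, hnorm]
    have hr : cylRadius x ^ 2 = x 0 ^ 2 + x 1 ^ 2 := cylRadius_sq x
    refine ⟨-Complex.arg z, ?_⟩
    ext i
    fin_cases i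
    · simp [hcos, hsin]
      field_simp
      nlinarith [hr]
    · simp [hcos, hsin]
      field_simp
      ring
    · simp

/-- For an axisymmetric field, `‖u‖` is invariant under rotations about the axis. [folklore] -/
theorem IsAxisymmetric.norm_rotZ_apply {v : EuclideanSpace ℝ (Fin 3) → EuclideanSpace ℝ (Fin 3)}
    (hv : IsAxisymmetric v) (θ : ℝ) (x : EuclideanSpace ℝ (Fin 3)) :
    ‖v (rotZ θ x)‖ = ‖v x‖ := by
  rw [hv θ x, norm_rotZ]

/-! ### Step 2: `f = |x'| ‖u‖` on sub-slabs, and near-maximisers of its running supremum -/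

section Selection

variable {T : ℝ} {u : ℝ → EuclideanSpace ℝ (Fin 3) → EuclideanSpace ℝ (Fin 3)}

/-- **`f` is bounded on every sub-slab.** If `u` is bounded on `(0, T') × ℝ³` for every `T' < T`
and satisfies (assumption2) `|x'| ‖u‖ ≤ C₂` for `|x'| ≥ R₀` on `(0, T) × ℝ³`, then
`f = |x'| ‖u‖` is bounded on `(0, T') × ℝ³` for every `T' < T` (by `max C₂ (R₀ sup ‖u‖)`), so
that an unbounded `f` forces `t_k → T` (KNSS 2009, proof of Thm 6.2, p. 12: "choose `t_k ↗ T`"). [cite: KochNadirashviliSereginSverak2009, proof of Thm 6.2 (arXiv p. 12)] -/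
theorem knss_rMulNorm_le_of_subslab (hbdd : ∀ T' < T, ∃ M : ℝ, ∀ t ∈ Ioo 0 T', ∀ x, ‖u t x‖ ≤ M)
    {C₂ R₀ : ℝ} (hdecay : ∀ t ∈ Ioo 0 T, ∀ x, R₀ ≤ cylRadius x → cylRadius x * ‖u t x‖ ≤ C₂)
    {T' : ℝ} (hT' : T' < T) :
    ∃ B : ℝ, ∀ t ∈ Ioo 0 T', ∀ x, cylRadius x * ‖u t x‖ ≤ B := by
  obtain ⟨M, hM⟩ := hbdd T' hT'
  refine ⟨max C₂ (max R₀ 0 * max M 0), fun t ht x => ?_⟩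
  by_cases hx : R₀ ≤ cylRadius x
  · exact (hdecay t ⟨ht.1, ht.2.trans hT'⟩ x hx).trans (le_max_left _ _)
  · have h1 : cylRadius x ≤ max R₀ 0 := (not_le.1 hx).le.trans (le_max_left _ _)
    have h2 : ‖u t x‖ ≤ max M 0 := (hM t ht x).trans (le_max_left _ _)
    calc cylRadius x * ‖u t x‖ ≤ max R₀ 0 * max M 0 :=
          mul_le_mul h1 h2 (norm_nonneg _) (le_max_right _ _)
      _ ≤ max C₂ (max R₀ 0 * max M 0) := le_max_right _ _

/-- **Near-maximisers of the running supremum.** Under the hypotheses of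
`knss_rMulNorm_le_of_subslab`, if `f = |x'| ‖u‖` is unbounded on `(0, T) × ℝ³` then for every
threshold `N` there are `t ∈ (0, T)` and `x` with `f(x, t) ≥ N`, `f(x, t) > 0` and
`f ≤ 2 f(x, t)` on `(0, t] × ℝ³` (KNSS 2009, proof of Thm 6.2, p. 12: `M_k = f(x_k, t_k) =
h(t_k) = H(t_k) ↗ ∞`, with near- instead of exact maximisers: the running supremum
`H(t₁) = sup_{(0, t₁] × ℝ³} f` is finite by `knss_rMulNorm_le_of_subslab`, and a value above
`H(t₁)/2` is a near-maximum of its own running supremum). [cite: KochNadirashviliSereginSverak2009, proof of Thm 6.2 (arXiv p. 12)] -/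
theorem knss_exists_near_running_max
    (hbdd : ∀ T' < T, ∃ M : ℝ, ∀ t ∈ Ioo 0 T', ∀ x, ‖u t x‖ ≤ M)
    {C₂ R₀ : ℝ} (hdecay : ∀ t ∈ Ioo 0 T, ∀ x, R₀ ≤ cylRadius x → cylRadius x * ‖u t x‖ ≤ C₂)
    (hunb : ∀ C' : ℝ, ∃ t ∈ Ioo 0 T, ∃ x, C' < cylRadius x * ‖u t x‖) (N : ℝ) :
    ∃ t ∈ Ioo 0 T, ∃ x, N ≤ cylRadius x * ‖u t x‖ ∧ 0 < cylRadius x * ‖u t x‖ ∧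
      ∀ τ ∈ Ioc 0 t, ∀ y, cylRadius y * ‖u τ y‖ ≤ 2 * (cylRadius x * ‖u t x‖) := by
  obtain ⟨t₁, ht₁, x₁, hx₁⟩ := hunb (max (2 * N) 1)
  -- the running supremum up to `t₁` is finite
  set A : Set ℝ := {r | ∃ τ ∈ Ioc 0 t₁, ∃ y, r = cylRadius y * ‖u τ y‖} with hA
  have hT₁ : (t₁ + T) / 2 < T := by linarith [ht₁.2]
  obtain ⟨B, hB⟩ := knss_rMulNorm_le_of_subslab hbdd hdecay hT₁
  have hAbdd : BddAbove A := by
    refine ⟨B, ?_⟩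
    rintro r ⟨τ, hτ, y, rfl⟩
    exact hB τ ⟨hτ.1, by linarith [hτ.2, ht₁.2]⟩ y
  have hmem : cylRadius x₁ * ‖u t₁ x₁‖ ∈ A := ⟨t₁, ⟨ht₁.1, le_rfl⟩, x₁, rfl⟩
  have hAne : A.Nonempty := ⟨_, hmem⟩
  set s := sSup A with hs
  have h1s : cylRadius x₁ * ‖u t₁ x₁‖ ≤ s := le_csSup hAbdd hmem
  have hspos : 0 < s := by
    have : (1 : ℝ) ≤ max (2 * N) 1 := le_max_right _ _
    linarith
  obtain ⟨r, ⟨τ, hτ, y, rfl⟩, hr⟩ := exists_lt_of_lt_csSup hAne (by linarith : s / 2 < s)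
  refine ⟨τ, ⟨hτ.1, lt_of_le_of_lt hτ.2 ht₁.2⟩, y, ?_, by linarith, fun τ' hτ' y' => ?_⟩
  · have : 2 * N ≤ cylRadius x₁ * ‖u t₁ x₁‖ := ((le_max_left _ _).trans hx₁.le)
    linarith
  · have hmem' : cylRadius y' * ‖u τ' y'‖ ∈ A := ⟨τ', ⟨hτ'.1, hτ'.2.trans hτ.2⟩, y', rfl⟩
    have := le_csSup hAbdd hmem'
    linarith

/-- **Step 2 of the proof of KNSS Theorem 6.2, packaged** (arXiv:0709.3599 p. 12). Let `T > 0`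
and let `u` on `(0, T) × ℝ³` be bounded on the sub-slabs, with axisymmetric slices and
(assumption2) `|x'| ‖u‖ ≤ C₂` for `|x'| ≥ R₀ > 0`; suppose `f = |x'| ‖u‖` is unbounded. Then
there are times `t_k ∈ [T/2, T)`, axial heights `a_k`, radii `0 < λ_k < R₀` and values `M_k`
with `M_k ≥ k + 1`, `M_k = λ_k ‖u(t_k, a_k e₃ + λ_k e₁)‖` (the point `x_k` rotated onto the
meridian half-plane, `exists_rotZ_eq_single_add_smul`, using the axisymmetry of `u(t_k, ·)`), and
`f ≤ 2 M_k` on `(0, t_k] × ℝ³` (near-maximality of the running supremum). (`t_k ≥ T/2` and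
`λ_k < R₀` because `M_k` exceeds the bound of `f` on `(0, T/2) × ℝ³` and `C₂`; `R₀ > 0` is not
needed for this step.) [cite: KochNadirashviliSereginSverak2009, proof of Thm 6.2 (arXiv p. 12)] -/
theorem knss_exists_blowup_sequence (hT : 0 < T)
    (hbdd : ∀ T' < T, ∃ M : ℝ, ∀ t ∈ Ioo 0 T', ∀ x, ‖u t x‖ ≤ M)
    (haxi : ∀ t ∈ Ioo 0 T, IsAxisymmetric (u t))
    {C₂ R₀ : ℝ} (hdecay : ∀ t ∈ Ioo 0 T, ∀ x, R₀ ≤ cylRadius x → cylRadius x * ‖u t x‖ ≤ C₂)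
    (hunb : ∀ C' : ℝ, ∃ t ∈ Ioo 0 T, ∃ x, C' < cylRadius x * ‖u t x‖) :
    ∃ (t a lam M : ℕ → ℝ), ∀ k,
      t k ∈ Ioo 0 T ∧ T / 2 ≤ t k ∧ 0 < lam k ∧ lam k < R₀ ∧ (k : ℝ) + 1 ≤ M k ∧
      lam k * ‖u (t k) (EuclideanSpace.single 2 (a k) + lam k • EuclideanSpace.single 0 1)‖ = M k ∧
      ∀ τ ∈ Ioc 0 (t k), ∀ y, cylRadius y * ‖u τ y‖ ≤ 2 * M k := by
  -- the bound of `f` on the lower half `(0, T/2) × ℝ³`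
  obtain ⟨B₀, hB₀⟩ := knss_rMulNorm_le_of_subslab hbdd hdecay (by linarith : T / 2 < T)
  -- pointwise choice above the threshold `N k`
  have key : ∀ k : ℕ, ∃ t ∈ Ioo 0 T, ∃ (a lam M : ℝ),
      T / 2 ≤ t ∧ 0 < lam ∧ lam < R₀ ∧ (k : ℝ) + 1 ≤ M ∧
      lam * ‖u t (EuclideanSpace.single 2 a + lam • EuclideanSpace.single 0 1)‖ = M ∧
      ∀ τ ∈ Ioc 0 t, ∀ y, cylRadius y * ‖u τ y‖ ≤ 2 * M := by
    intro k
    obtain ⟨t, ht, x, hN, hpos, hmax⟩ := knss_exists_near_running_max hbdd hdecay hunb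
      (max (max ((k : ℝ) + 1) (C₂ + 1)) (B₀ + 1))
    obtain ⟨θ, hθ⟩ := exists_rotZ_eq_single_add_smul x
    refine ⟨t, ht, x 2, cylRadius x, cylRadius x * ‖u t x‖, ?_, ?_, ?_, ?_, ?_, hmax⟩
    · by_contra hlt
      have := hB₀ t ⟨ht.1, not_le.1 hlt⟩ x
      have : B₀ + 1 ≤ cylRadius x * ‖u t x‖ := (le_max_right _ _).trans hN
      linarith
    · rcases (cylRadius_nonneg x).eq_or_lt with h0 | h0
      · rw [← h0, zero_mul] at hpos
        exact absurd hpos (lt_irrefl 0)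
      · exact h0
    · by_contra hle
      have := hdecay t ht x (not_lt.1 hle)
      have : C₂ + 1 ≤ cylRadius x * ‖u t x‖ := ((le_max_right _ _).trans (le_max_left _ _)).trans hN
      linarith
    · exact ((le_max_left _ _).trans (le_max_left _ _)).trans hN
    · rw [← hθ, (haxi t ht).norm_rotZ_apply]
  choose t ht a lam M hprop using key
  exact ⟨t, a, lam, M, fun k => ⟨ht k, hprop k⟩⟩

end Selection

end Literature.Analysis.FluidPDE

end
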